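import Mathlib
import HarnessLib
import Literature.Computability.AlgebraicComplexity.HessianRank
import Summits.PneNP.PneNP.Theorems.CnfIdealGenLengthRankDefectRepresentationsTseitinTransferDefs

/-!
# Crux `RankDefectRepresentations` (stmt-PneNP-18923), line `rank-dehn-ladder`, stub `stub_tseitinTransfer`: rank bookkeeping

Elementary rank algebra for ALMOST-REPRESENTATIONS (matrix tuples `M` whose Boolean defects `M_i² - M_i` and commutators
`[M_i, M_j]` have rank `≤ t`) and the TRUTH-VALUE matrices `Y_g = 1 - tr(g)(M)` of formulas `g`
(`tr` = `Literature.Computability.MetaComplexity.NCIPS.tr` [LiTzameretWang2018, Def. 1.3]):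
* `rk_*` — subadditivity and the shape identities used for the Tseitin clause words
  (`PQPQ - PQ = (PP-P)QQ + P(QQ-Q) + P[Q,P]Q`, `PQ(1-P)`, `PQ(1-Q)`, `(1-PQ)PQ`, `1 - prod (1 - W)`);
* `tv_*` — the recursive identities `Y(x_i) = M_i`, `Y(neg g) = 1 - Y(g)`, `Y(a conj b) = Y(a) Y(b)`,
  `Y(a disj b) = 1 - (1-Y(a))(1-Y(b))`;
* `rank_comm_tv_le` — `rank [Y(g), X] ≤ size(g) · c` if every `rank [M_i, X] ≤ c` (Leibniz);
* `rank_defect_tv_le` — `rank (Y(g)² - Y(g)) ≤ size(g)² · t` (almost-idempotency of truth values);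
* clause shapes `rk_shape_*` and the commutator bounds `rank_comm_letter_tv_le`, `rank_comm_tv_tv_le`.
HONEST FRAMING: bookkeeping for one rung (the transfer stub) of the ladder skeleton; P ≠ NP is not moved; F-N2 is a FRONTIER
formal rung.
-/

set_option linter.dupNamespace false -- `Summit.PneNP.PneNP.…`: summit = sub-problem name (D-0017)

namespace Summit.PneNP.PneNP.Theorems.CnfIdealGenLengthRankDefectRepresentationsTseitinTransfer

open Literature.Computability.Complexity
open Literature.Computability.MetaComplexity
open Literature.Computability.MetaComplexity.NCIPS

/-! ## Rank bookkeeping for truth-value matrices (file …TseitinTransferRank) -/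

section Rank

variable {K : Type} [Field K] {d : ℕ}

/-- `rank (A + B) ≤ rank A + rank B` (re-export of the tree lemma, for brevity). [folklore] -/
theorem rk_add (A B : Matrix (Fin d) (Fin d) K) : (A + B).rank ≤ A.rank + B.rank :=
  Literature.Computability.AlgebraicComplexity.rank_add_le A B

/-- `rank (-A) = rank A`. [folklore] -/
theorem rk_neg (A : Matrix (Fin d) (Fin d) K) : (-A).rank = A.rank := by
  rw [show -A = (-1 : Matrix (Fin d) (Fin d) K) * A by simp, Matrix.rank_mul_eq_right_of_isUnit_det]
  simp [Matrix.det_neg, Matrix.det_one]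

/-- `rank (A - B) ≤ rank A + rank B`. [folklore] -/
theorem rk_sub (A B : Matrix (Fin d) (Fin d) K) : (A - B).rank ≤ A.rank + B.rank := by
  rw [sub_eq_add_neg]; exact (rk_add A (-B)).trans (by rw [rk_neg])

/-- The idempotency defect of `1 - P` equals that of `P`. [folklore] -/
theorem rk_defect_one_sub (P : Matrix (Fin d) (Fin d) K) : ((1 - P) * (1 - P) - (1 - P)).rank = (P * P - P).rank := by
  have : (1 - P) * (1 - P) - (1 - P) = P * P - P := by noncomm_ring
  rw [this]

/-- Commutators with `1 - P` are commutators with `P`. [folklore] -/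
theorem rk_comm_one_sub (P X : Matrix (Fin d) (Fin d) K) : ((1 - P) * X - X * (1 - P)).rank = (P * X - X * P).rank := by
  have : (1 - P) * X - X * (1 - P) = -(P * X - X * P) := by noncomm_ring
  rw [this, rk_neg]

/-- Commutator of a product: `rank [PQ, X] ≤ rank [P, X] + rank [Q, X]`. [folklore] -/
theorem rk_comm_mul (P Q X : Matrix (Fin d) (Fin d) K) :
    (P * Q * X - X * (P * Q)).rank ≤ (P * X - X * P).rank + (Q * X - X * Q).rank := by
  have : P * Q * X - X * (P * Q) = (P * X - X * P) * Q + P * (Q * X - X * Q) := by noncomm_ring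
  rw [this]
  exact (rk_add _ _).trans (Nat.add_le_add (Matrix.rank_mul_le_left _ _) (Matrix.rank_mul_le_right _ _))

/-- Idempotency defect of a product of almost-commuting almost-idempotents:
`PQPQ - PQ = (P²-P)Q² + P(Q²-Q) + P[Q,P]Q`. [folklore] -/
theorem rk_defect_mul (P Q : Matrix (Fin d) (Fin d) K) :
    (P * Q * (P * Q) - P * Q).rank ≤ (P * P - P).rank + (Q * Q - Q).rank + (Q * P - P * Q).rank := by
  have : P * Q * (P * Q) - P * Q = (P * P - P) * (Q * Q) + P * (Q * Q - Q) + P * (Q * P - P * Q) * Q := by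
    noncomm_ring
  rw [this]
  refine (rk_add _ _).trans (Nat.add_le_add ((rk_add _ _).trans (Nat.add_le_add ?_ ?_)) ?_)
  · exact Matrix.rank_mul_le_left _ _
  · exact Matrix.rank_mul_le_right _ _
  · exact (Matrix.rank_mul_le_left _ _).trans (Matrix.rank_mul_le_right _ _)

/-- Clause shape `P Q (1 - P)`: rank `≤ defect(P) + rank [Q, P]`. [folklore] -/
theorem rk_shape_pqnp (P Q : Matrix (Fin d) (Fin d) K) :
    (P * Q * (1 - P)).rank ≤ (P * P - P).rank + (Q * P - P * Q).rank := by
  have : P * Q * (1 - P) = -((P * P - P) * Q) - P * (Q * P - P * Q) := by noncomm_ring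
  rw [this]
  refine (rk_sub _ _).trans (Nat.add_le_add ?_ ?_)
  · rw [rk_neg]; exact Matrix.rank_mul_le_left _ _
  · exact Matrix.rank_mul_le_right _ _

/-- Clause shape `P Q (1 - Q)`: rank `≤ defect(Q)`. [folklore] -/
theorem rk_shape_pqnq (P Q : Matrix (Fin d) (Fin d) K) : (P * Q * (1 - Q)).rank ≤ (Q * Q - Q).rank := by
  have : P * Q * (1 - Q) = -(P * (Q * Q - Q)) := by noncomm_ring
  rw [this, rk_neg]; exact Matrix.rank_mul_le_right _ _

/-- Clause shape `(1 - P Q) P Q`: rank `≤ defect(P) + defect(Q) + rank [Q, P]`. [folklore] -/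
theorem rk_shape_npq_pq (P Q : Matrix (Fin d) (Fin d) K) :
    ((1 - P * Q) * (P * Q)).rank ≤ (P * P - P).rank + (Q * Q - Q).rank + (Q * P - P * Q).rank := by
  have : (1 - P * Q) * (P * Q) = -(P * Q * (P * Q) - P * Q) := by noncomm_ring
  rw [this, rk_neg]; exact rk_defect_mul P Q

/-- `rank (1 - ∏_{x ∈ l} (1 - W x)) ≤ |l| · B` when every `rank (W x) ≤ B` (ordered product). [folklore] -/
theorem rk_one_sub_prod_map_le {ι : Type*} (W : ι → Matrix (Fin d) (Fin d) K) (B : ℕ) :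
    ∀ l : List ι, (∀ x ∈ l, (W x).rank ≤ B) → (1 - (l.map fun x => 1 - W x).prod).rank ≤ l.length * B
  | [], _ => by simp
  | x :: l, h => by
      simp only [List.map_cons, List.prod_cons, List.length_cons]
      have : (1 : Matrix (Fin d) (Fin d) K) - (1 - W x) * (l.map fun x => 1 - W x).prod =
          (1 - (l.map fun x => 1 - W x).prod) + W x * (l.map fun x => 1 - W x).prod := by noncomm_ring
      rw [this]
      refine (rk_add _ _).trans ?_
      have h1 := rk_one_sub_prod_map_le W B l (fun y hy => h y (by simp [hy]))
      have h2 : (W x * (l.map fun x => 1 - W x).prod).rank ≤ B :=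
        (Matrix.rank_mul_le_left _ _).trans (h x (by simp))
      rw [Nat.succ_mul]; omega

/-- `rank A ≤ rank (U A) + rank (1 - U)`. [folklore] -/
theorem rk_le_rank_mul_add (U A : Matrix (Fin d) (Fin d) K) : A.rank ≤ (U * A).rank + (1 - U).rank := by
  have : A = U * A + (1 - U) * A := by noncomm_ring
  conv_lhs => rw [this]
  exact (rk_add _ _).trans (Nat.add_le_add_left (Matrix.rank_mul_le_left _ _) _)

end Rank

/-! ## Truth-value matrices of subformulas -/

section TruthValue

variable {K : Type} [Field K] {n d : ℕ}

/-- Shorthand for evaluation at the tuple `M` (not a definition: a notation-free abbreviation via `letI` is avoided;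
we state lemmas with the explicit `MonoidAlgebra.lift` term). -/
theorem lift_X_eq (M : Fin n → Matrix (Fin d) (Fin d) K) (i : Fin n) :
    MonoidAlgebra.lift K (Matrix (Fin d) (Fin d) K) (FreeMonoid (Fin n)) (FreeMonoid.lift M) (X K i) = M i := by
  simp [X]

/-- Truth value of a variable: `1 − tr(x_i)(M) = M i`. [cite: LiTzameretWang2018, Def. 1.3] -/
theorem tv_var (M : Fin n → Matrix (Fin d) (Fin d) K) (i : Fin n) :
    1 - MonoidAlgebra.lift K (Matrix (Fin d) (Fin d) K) (FreeMonoid (Fin n)) (FreeMonoid.lift M) (tr K (.var i)) = M i := by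
  rw [tr_var, map_sub, map_one, lift_X_eq]; abel

/-- Truth value of a constant. [cite: LiTzameretWang2018, Def. 1.3] -/
theorem tv_const (M : Fin n → Matrix (Fin d) (Fin d) K) (b : Bool) :
    1 - MonoidAlgebra.lift K (Matrix (Fin d) (Fin d) K) (FreeMonoid (Fin n)) (FreeMonoid.lift M) (tr K (.const b)) =
      if b then 1 else 0 := by
  rw [tr_const]; cases b <;> simp

/-- Truth value of a negation: `1 − tr(¬g) = 1 − (1 − tr g)`. [cite: LiTzameretWang2018, Def. 1.3] -/
theorem tv_neg (M : Fin n → Matrix (Fin d) (Fin d) K) (g : PropForm (Fin n)) :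
    1 - MonoidAlgebra.lift K (Matrix (Fin d) (Fin d) K) (FreeMonoid (Fin n)) (FreeMonoid.lift M) (tr K (.neg g)) =
      1 - (1 - MonoidAlgebra.lift K (Matrix (Fin d) (Fin d) K) (FreeMonoid (Fin n)) (FreeMonoid.lift M) (tr K g)) := by
  rw [tr_neg, map_sub, map_one]

/-- Truth value of a conjunction: product of the truth values. [cite: LiTzameretWang2018, Def. 1.3] -/
theorem tv_conj (M : Fin n → Matrix (Fin d) (Fin d) K) (a b : PropForm (Fin n)) :
    1 - MonoidAlgebra.lift K (Matrix (Fin d) (Fin d) K) (FreeMonoid (Fin n)) (FreeMonoid.lift M) (tr K (.conj a b)) =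
      (1 - MonoidAlgebra.lift K (Matrix (Fin d) (Fin d) K) (FreeMonoid (Fin n)) (FreeMonoid.lift M) (tr K a)) *
        (1 - MonoidAlgebra.lift K (Matrix (Fin d) (Fin d) K) (FreeMonoid (Fin n)) (FreeMonoid.lift M) (tr K b)) := by
  rw [tr_conj]; simp only [map_sub, map_one, map_mul, sub_sub_cancel]

/-- Truth value of a disjunction: `1 − (1 − Y_a)(1 − Y_b)`. [cite: LiTzameretWang2018, Def. 1.3] -/
theorem tv_disj (M : Fin n → Matrix (Fin d) (Fin d) K) (a b : PropForm (Fin n)) :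
    1 - MonoidAlgebra.lift K (Matrix (Fin d) (Fin d) K) (FreeMonoid (Fin n)) (FreeMonoid.lift M) (tr K (.disj a b)) =
      1 - (1 - (1 - MonoidAlgebra.lift K (Matrix (Fin d) (Fin d) K) (FreeMonoid (Fin n)) (FreeMonoid.lift M) (tr K a))) *
        (1 - (1 - MonoidAlgebra.lift K (Matrix (Fin d) (Fin d) K) (FreeMonoid (Fin n)) (FreeMonoid.lift M) (tr K b))) := by
  rw [tr_disj, map_mul]; simp

/-- **Almost-centrality of truth values.** If `X` commutes with every `M i` up to rank `c`, then it commutes with the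
truth-value matrix of every formula `g` up to rank `size(g) · c` (Leibniz expansion of the commutator). [folklore] -/
theorem rank_comm_tv_le (M : Fin n → Matrix (Fin d) (Fin d) K) (X : Matrix (Fin d) (Fin d) K) (c : ℕ)
    (hc : ∀ i, (M i * X - X * M i).rank ≤ c) :
    ∀ g : PropForm (Fin n),
      ((1 - MonoidAlgebra.lift K (Matrix (Fin d) (Fin d) K) (FreeMonoid (Fin n)) (FreeMonoid.lift M) (tr K g)) * X -
        X * (1 - MonoidAlgebra.lift K (Matrix (Fin d) (Fin d) K) (FreeMonoid (Fin n)) (FreeMonoid.lift M) (tr K g))).rank ≤ g.size * c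
  | .var i => by rw [tv_var]; simpa [PropForm.size] using hc i
  | .const b => by
      rw [tv_const]; cases b <;> simp [PropForm.size]
  | .neg g => by
      rw [tv_neg, rk_comm_one_sub]
      exact (rank_comm_tv_le M X c hc g).trans (Nat.mul_le_mul_right _ (by simp [PropForm.size]))
  | .conj a b => by
      rw [tv_conj]
      refine (rk_comm_mul _ _ _).trans ?_
      have ha := rank_comm_tv_le M X c hc a; have hb := rank_comm_tv_le M X c hc b
      have : a.size * c + b.size * c ≤ (PropForm.conj a b).size * c := by
        simp only [PropForm.size]; nlinarith
      omega
  | .disj a b => by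
      rw [tv_disj, sub_sub_cancel, sub_sub_cancel, rk_comm_one_sub]
      refine (rk_comm_mul _ _ _).trans ?_
      have ha := rank_comm_tv_le M X c hc a; have hb := rank_comm_tv_le M X c hc b
      rw [rk_comm_one_sub] at ha hb
      have : a.size * c + b.size * c ≤ (PropForm.disj a b).size * c := by
        simp only [PropForm.size]; nlinarith
      omega

/-- **Almost-idempotency of truth values.** Under an almost-representation (Boolean and commutator defects `≤ t`), the
truth-value matrix of `g` is idempotent up to rank `size(g)² · t`. [folklore] -/
theorem rank_defect_tv_le (M : Fin n → Matrix (Fin d) (Fin d) K) (t : ℕ) (hB : ∀ i, (M i * M i - M i).rank ≤ t)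
    (hC : ∀ i j, (M i * M j - M j * M i).rank ≤ t) :
    ∀ g : PropForm (Fin n),
      ((1 - MonoidAlgebra.lift K (Matrix (Fin d) (Fin d) K) (FreeMonoid (Fin n)) (FreeMonoid.lift M) (tr K g)) *
          (1 - MonoidAlgebra.lift K (Matrix (Fin d) (Fin d) K) (FreeMonoid (Fin n)) (FreeMonoid.lift M) (tr K g)) -
        (1 - MonoidAlgebra.lift K (Matrix (Fin d) (Fin d) K) (FreeMonoid (Fin n)) (FreeMonoid.lift M) (tr K g))).rank ≤ g.size ^ 2 * t
  | .var i => by rw [tv_var]; simpa [PropForm.size] using hB i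
  | .const b => by rw [tv_const]; cases b <;> simp
  | .neg g => by
      rw [tv_neg, rk_defect_one_sub]
      exact (rank_defect_tv_le M t hB hC g).trans
        (Nat.mul_le_mul_right _ (Nat.pow_le_pow_left (by simp [PropForm.size]) 2))
  | .conj a b => by
      rw [tv_conj]
      refine (rk_defect_mul _ _).trans ?_
      have ha := rank_defect_tv_le M t hB hC a; have hb := rank_defect_tv_le M t hB hC b
      have hcomm := rank_comm_tv_le M
        (1 - MonoidAlgebra.lift K (Matrix (Fin d) (Fin d) K) (FreeMonoid (Fin n)) (FreeMonoid.lift M) (tr K a)) (a.size * t)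
        (fun i => by
          have := rank_comm_tv_le M (M i) t (fun j => hC j i) a
          rw [← rk_neg]; convert this using 2; noncomm_ring) b
      have harith : a.size ^ 2 * t + b.size ^ 2 * t + b.size * (a.size * t) ≤ (PropForm.conj a b).size ^ 2 * t := by
        simp only [PropForm.size]
        have : a.size ^ 2 + b.size ^ 2 + b.size * a.size ≤ (a.size + b.size + 1) ^ 2 := by nlinarith
        calc a.size ^ 2 * t + b.size ^ 2 * t + b.size * (a.size * t)
            = (a.size ^ 2 + b.size ^ 2 + b.size * a.size) * t := by ring
          _ ≤ (a.size + b.size + 1) ^ 2 * t := Nat.mul_le_mul_right t this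
      omega
  | .disj a b => by
      rw [tv_disj, sub_sub_cancel, sub_sub_cancel, rk_defect_one_sub]
      refine (rk_defect_mul _ _).trans ?_
      have ha := rank_defect_tv_le M t hB hC a; have hb := rank_defect_tv_le M t hB hC b
      rw [rk_defect_one_sub] at ha hb
      have hcomm := rank_comm_tv_le M
        (MonoidAlgebra.lift K (Matrix (Fin d) (Fin d) K) (FreeMonoid (Fin n)) (FreeMonoid.lift M) (tr K a)) (a.size * t)
        (fun i => by
          have := rank_comm_tv_le M (M i) t (fun j => hC j i) a
          rw [rk_comm_one_sub] at this
          rw [← rk_neg]; convert this using 2; noncomm_ring) b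
      rw [rk_comm_one_sub] at hcomm
      have harith : a.size ^ 2 * t + b.size ^ 2 * t + b.size * (a.size * t) ≤ (PropForm.disj a b).size ^ 2 * t := by
        simp only [PropForm.size]
        have : a.size ^ 2 + b.size ^ 2 + b.size * a.size ≤ (a.size + b.size + 1) ^ 2 := by nlinarith
        calc a.size ^ 2 * t + b.size ^ 2 * t + b.size * (a.size * t)
            = (a.size ^ 2 + b.size ^ 2 + b.size * a.size) * t := by ring
          _ ≤ (a.size + b.size + 1) ^ 2 * t := Nat.mul_le_mul_right t this
      omega

end TruthValue

/-! ## Clause shapes and commutator bookkeeping -/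

section Shape

variable {K : Type} [Field K] {n d : ℕ}

/-- Clause shape `(1 - A) A`. [folklore] -/
theorem rk_shape_na_a (A : Matrix (Fin d) (Fin d) K) : ((1 - A) * A).rank = (A * A - A).rank := by
  have : (1 - A) * A = -(A * A - A) := by noncomm_ring
  rw [this, rk_neg]

/-- Clause shape `A (1 - A)`. [folklore] -/
theorem rk_shape_a_na (A : Matrix (Fin d) (Fin d) K) : (A * (1 - A)).rank = (A * A - A).rank := by
  have : A * (1 - A) = -(A * A - A) := by noncomm_ring
  rw [this, rk_neg]

/-- Clause shape `(1 - (1 - A)) (1 - A)`. [folklore] -/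
theorem rk_shape_nna_na (A : Matrix (Fin d) (Fin d) K) : ((1 - (1 - A)) * (1 - A)).rank = (A * A - A).rank := by
  have : (1 - (1 - A)) * (1 - A) = -(A * A - A) := by noncomm_ring
  rw [this, rk_neg]

/-- Commutators of complements: `[1 - Q, 1 - P] = [Q, P]`. [folklore] -/
theorem rk_comm_one_sub_one_sub (P Q : Matrix (Fin d) (Fin d) K) :
    ((1 - Q) * (1 - P) - (1 - P) * (1 - Q)).rank = (Q * P - P * Q).rank := by
  have : (1 - Q) * (1 - P) - (1 - P) * (1 - Q) = Q * P - P * Q := by noncomm_ring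
  rw [this]

/-- Disjunction clause shape `(1 - (1-A)(1-B)) · (1-A)(1-B)`. [folklore] -/
theorem rk_shape_disj1 (A B : Matrix (Fin d) (Fin d) K) :
    ((1 - (1 - A) * (1 - B)) * ((1 - A) * (1 - B))).rank ≤
      (A * A - A).rank + (B * B - B).rank + (B * A - A * B).rank := by
  have h := rk_shape_npq_pq (1 - A) (1 - B)
  rwa [rk_defect_one_sub, rk_defect_one_sub, rk_comm_one_sub_one_sub] at h

/-- Disjunction clause shape `(1 - (1 - (1-A)(1-B))) · A`. [folklore] -/
theorem rk_shape_disj2 (A B : Matrix (Fin d) (Fin d) K) :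
    ((1 - (1 - (1 - A) * (1 - B))) * A).rank ≤ (A * A - A).rank + (B * A - A * B).rank := by
  have h := rk_shape_pqnp (1 - A) (1 - B)
  rw [rk_defect_one_sub, rk_comm_one_sub_one_sub, sub_sub_cancel] at h
  rwa [sub_sub_cancel]

/-- Disjunction clause shape `(1 - (1 - (1-A)(1-B))) · B`. [folklore] -/
theorem rk_shape_disj3 (A B : Matrix (Fin d) (Fin d) K) :
    ((1 - (1 - (1 - A) * (1 - B))) * B).rank ≤ (B * B - B).rank := by
  have h := rk_shape_pqnq (1 - A) (1 - B)
  rw [rk_defect_one_sub, sub_sub_cancel] at h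
  rwa [sub_sub_cancel]

/-- Monotone bookkeeping: `a² t ≤ s² t` for `a ≤ s`. [folklore] -/
theorem sq_mul_le_sq_mul {a s t : ℕ} (ha : a ≤ s) : a ^ 2 * t ≤ s ^ 2 * t :=
  Nat.mul_le_mul_right t (Nat.pow_le_pow_left ha 2)

/-- Monotone bookkeeping: `b (a t) ≤ s² t` for `a, b ≤ s`. [folklore] -/
theorem mul_mul_le_sq_mul {a b s t : ℕ} (ha : a ≤ s) (hb : b ≤ s) : b * (a * t) ≤ s ^ 2 * t := by
  rw [← mul_assoc, sq]; exact Nat.mul_le_mul_right t (Nat.mul_le_mul hb ha)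

/-- Commutator of a letter with a truth value: `rank [M_i, Y_a] ≤ size(a) · t`. [folklore] -/
theorem rank_comm_letter_tv_le (M : Fin n → Matrix (Fin d) (Fin d) K) (t : ℕ) (hC : ∀ i j, (M i * M j - M j * M i).rank ≤ t)
    (a : PropForm (Fin n)) (i : Fin n) :
    (M i * (1 - MonoidAlgebra.lift K (Matrix (Fin d) (Fin d) K) (FreeMonoid (Fin n)) (FreeMonoid.lift M) (tr K a)) -
      (1 - MonoidAlgebra.lift K (Matrix (Fin d) (Fin d) K) (FreeMonoid (Fin n)) (FreeMonoid.lift M) (tr K a)) * M i).rank ≤ a.size * t := by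
  have := rank_comm_tv_le M (M i) t (fun j => hC j i) a
  rw [← rk_neg]; convert this using 2; noncomm_ring

/-- Commutator of two truth values: `rank [Y_b, Y_a] ≤ size(b) · size(a) · t`. [folklore] -/
theorem rank_comm_tv_tv_le (M : Fin n → Matrix (Fin d) (Fin d) K) (t : ℕ) (hC : ∀ i j, (M i * M j - M j * M i).rank ≤ t)
    (a b : PropForm (Fin n)) :
    ((1 - MonoidAlgebra.lift K (Matrix (Fin d) (Fin d) K) (FreeMonoid (Fin n)) (FreeMonoid.lift M) (tr K b)) *
        (1 - MonoidAlgebra.lift K (Matrix (Fin d) (Fin d) K) (FreeMonoid (Fin n)) (FreeMonoid.lift M) (tr K a)) -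
      (1 - MonoidAlgebra.lift K (Matrix (Fin d) (Fin d) K) (FreeMonoid (Fin n)) (FreeMonoid.lift M) (tr K a)) *
        (1 - MonoidAlgebra.lift K (Matrix (Fin d) (Fin d) K) (FreeMonoid (Fin n)) (FreeMonoid.lift M) (tr K b))).rank ≤
      b.size * (a.size * t) :=
  rank_comm_tv_le M _ (a.size * t) (fun i => rank_comm_letter_tv_le M t hC a i) b

end Shape

end Summit.PneNP.PneNP.Theorems.CnfIdealGenLengthRankDefectRepresentationsTseitinTransfer
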